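/-
Origin: expansion seat `planner-pub-hodgecm-mc-axioms-1-g14-0`, handover #W98 2026-08-20T15:53:55Z md5 c385800dd59a (PKG fa6818597b18 → c385800dd59a; 168 l.; MECHANICAL (iib-R) rewrite v3.1 of the PKG file as it stands (52 token edits; rules R1x1+R2x11+RX[h₂']x22+R3x3+R8x15)) (`HOME/mc/pub-hodgecm-mc-axioms-1-g14/revendor/kit-r55/stage55/HodgeCM/Model/ClassMapInstance.lean`, md5 c385800dd59a, 168 lines);
landed by the gen-22 packager (p-g22) in gate run 55 REPLACES the earlier landed copy of `HodgeCM/Model/ClassMapInstance.lean` (seat copy carried the packager Origin header of an earlier run (stripped)).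
-/
/-
Unit pub-hodgecm-mc-autform-2-g4 (node D1-aut CLASSMAP, PKG half). NEW additive leaf `HodgeCM/Model/ClassMapInstance.lean`.
The class-map datum `D_Γ : WeightForms.ClassMapDatum ιinf hΔ hη (U.CohC (U.pms L ι₁ V Γ) 1)` of the model universe
`U := picardCMUniverse hHD hI h₁ hU h₃`, CONSTRUCTED from the tree leaf `UnitaryBallClassMap` (vendored twin) at the
ball-quotient datum `ballDatumOf … Γ h` of `X_Γ`: `H10 := F¹H¹(X_Γ)`, `pull := toGroup ∘ classLift` (the holomorphic lift
of `UnitaryBallHolomorphicLift`, = the evaluation `ev` of the geometric ball data), `Hol :=` holomorphic weight forms,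
`descends` PROVED (Borel §5.14 descent + Voisin I Cor. 7.6). 0 hypotheses beyond the universe rows `hHD hI h₁ hU h₃`;
expected `#print axioms`: {propext, Classical.choice, Quot.sound}.
-/
import Summits.HodgeConjecture.HodgeCM.Model.Universe
import Literature.AlgebraicGeometry.ShimuraVarieties.UnitaryBallClassMap

/-!
# The class-map datum `D_Γ` of the model universe (node D1-aut CLASSMAP)

For the Picard–CM model universe `U := picardCMUniverse hHD hI h₁ hU h₃`, a hermitian space `V` over the
CM field `L`, a level `Γ`, the anisotropic regime `h : IsAnisotropic L V.Hm` (always met when `2 < [L:ℚ]`,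
`isAnisotropic_of_two_lt`), a Sylvester frame `𝔣` of the ball-quotient datum `ballDatumOf … Γ h` of `X_Γ`
and ANY archimedean restriction situation `ιinf : U(2,1) →* G_U`, `hΔ` (level-corrected for
`Δ = (ballDatumOf … Γ h).ballImage 𝔣`), `hη` (weight-matched for `K₁ = Stab(x₀)`, `τ₁ = weightOf x₀` of the
cotangent cocycle), the term

  `Model.classMapDatumOf hHD hI h₁ hU h₃ Γ h 𝔣 ιinf hΔ hη :
     WeightForms.ClassMapDatum ιinf hΔ hη (U.CohC (U.pms L ι₁ V Γ) 1)`

— the `D` slot of `WeilPairData.ClassSupplyData` / the `D_Γ` of the E-side pin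
`Theta V c k Γ := WeightForms.thetaClasses ιinf D_Γ (thetaForms 𝓙 𝓕)` (MODEL-DAG RULING m1r R4 W7a-pin) — is the
vendored tree construction `UnitaryBallUniformisationDatum.classMapDatum` (Borel §5.14 dictionary ∘ Voisin I Cor. 7.6)
read on the universe's currency `U.CohC (U.pms L ι₁ V Γ) 1 = ℂ ⊗_ℚ H¹(X_Γ(ℂ); ℚ)` (definitional). Its fields,
unfolded (`classMapDatumOf_H10`, `_Hol`, `_pull_apply`):

* `H10 = (U.hodge (U.pms L ι₁ V Γ) 1).F 1` — the `(1,0)`-classes of the universe's Hodge structure;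
* `pull c = (g ↦ (Jac g x₀)ᵀ · (classLift c)(g x₀))` — the group function of the holomorphic lift
  `(ballDatumOf … Γ h).classLift hHD 𝔣` (so `pull` and the evaluation `ev Γ` of the geometric ball data, built
  from the same `classLift`, are ONE object);
* `Hol = BallForms.holWeightForms ((ballDatumOf … Γ h).ballImage 𝔣) cot`;
* `descends` — a THEOREM (`UnitaryBallUniformisationDatum.exists_mem_hodge_F_classPull_eq`);
* `pull` is injective (`classMapDatumOf_pull_injective`).

Consequently the theta classes of any space `Θ` of adelic weight forms are `(1,0)`-classes of `X_Γ`
(`thetaClasses_classMapDatumOf_subset`). Nothing here is asserted: 0 records, 0 hypotheses beyond the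
universe's rows; the adelic side (`ιinf`, `hΔ`, `hη`, `Θ`) is received as parameters.
-/

noncomputable section

open scoped Matrix TensorProduct
open MulAction NumberField
open Literature.Geometry.ComplexHyperbolic.BallModel (U21 Ball Jac x₀)
open Literature.NumberTheory.Automorphic
open Literature.NumberTheory.Automorphic.AutomorphyFactor
open Literature.AlgebraicGeometry.HodgeTheory
open Literature.AlgebraicGeometry.ShimuraVarieties

namespace HodgeCM

namespace Model

open Literature.NumberTheory.Automorphic.PicardCM

section EndState

variable (hHD : exists_isReal_hodgeModel) (hI : hodgePQ_independent_of_hodgeModel)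
  (h₁ : BallQuotientUniformised)  (h₃ : CMAbelianVarietyRealised)

variable {GU : Type*} [Group GU] {Kc : Type*} [Group Kc]
variable {ΓU : Subgroup GU} {κ : Kc →* GU} {τ : Representation ℂ Kc (Fin 2 → ℂ)}

/-- **The class-map datum `D_Γ` of the model universe** (anisotropic regime `h`, frame `𝔣`), over an
archimedean restriction situation `ιinf`, `hΔ`, `hη`: the tree's `UnitaryBallUniformisationDatum.classMapDatum` at
`ballDatumOf … Γ h`, typed on `U.CohC (U.pms L ι₁ V Γ) 1`. -/
def classMapDatumOf {L : CMField} {ι₁ : L →+* ℂ} {V : HermSpace3 L ι₁} (Γ : Level V)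
    (h : IsAnisotropic L V.Hm)
    (𝔣 : (ballDatumOf (hHD := hHD) (hI := hI) (hU := ballQuotientUniformisedDatum_of h₁) (h₃ := h₃)
      L ι₁ V Γ h).SylvesterFrame)
    (ιinf : U21 →* GU) {η₁ : stabilizer U21 x₀ →* Kc}
    (hΔ : WeightForms.IsLevelCorrected ΓU κ τ ιinf
      ((ballDatumOf (hHD := hHD) (hI := hI) (hU := ballQuotientUniformisedDatum_of h₁) (h₃ := h₃)
        L ι₁ V Γ h).ballImage 𝔣))
    (hη : WeightForms.IsWeightMatched κ τ ιinf (stabilizer U21 x₀).subtype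
      (BallForms.isPullbackCocycle_cotangentCocycle.weightOf x₀) η₁) :
    WeightForms.ClassMapDatum ιinf hΔ hη
      ((picardCMUniverse hHD hI h₁ h₃).CohC ((picardCMUniverse hHD hI h₁ h₃).pms L ι₁ V Γ) 1) :=
  (ballDatumOf (hHD := hHD) (hI := hI) (hU := ballQuotientUniformisedDatum_of h₁) (h₃ := h₃)
    L ι₁ V Γ h).classMapDatum hHD 𝔣 hI ιinf hΔ hη

variable {L : CMField} {ι₁ : L →+* ℂ} {V : HermSpace3 L ι₁} (Γ : Level V) (h : IsAnisotropic L V.Hm)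
  (𝔣 : (ballDatumOf (hHD := hHD) (hI := hI) (hU := ballQuotientUniformisedDatum_of h₁) (h₃ := h₃)
    L ι₁ V Γ h).SylvesterFrame)
  (ιinf : U21 →* GU) {η₁ : stabilizer U21 x₀ →* Kc}
  (hΔ : WeightForms.IsLevelCorrected ΓU κ τ ιinf
    ((ballDatumOf (hHD := hHD) (hI := hI) (hU := ballQuotientUniformisedDatum_of h₁) (h₃ := h₃)
      L ι₁ V Γ h).ballImage 𝔣))
  (hη : WeightForms.IsWeightMatched κ τ ιinf (stabilizer U21 x₀).subtype
    (BallForms.isPullbackCocycle_cotangentCocycle.weightOf x₀) η₁)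

/-- `H10` of `D_Γ` is `F¹` of the universe's Hodge structure on `H¹(X_Γ)`. -/
@[simp] theorem classMapDatumOf_H10 :
    (classMapDatumOf hHD hI h₁ h₃ Γ h 𝔣 ιinf hΔ hη).H10 =
      ((picardCMUniverse hHD hI h₁ h₃).hodge ((picardCMUniverse hHD hI h₁ h₃).pms L ι₁ V Γ) 1).F 1 :=
  rfl

/-- `Hol` of `D_Γ` is the space of holomorphic weight forms of level `ballImage 𝔣`. -/
@[simp] theorem classMapDatumOf_Hol :
    (classMapDatumOf hHD hI h₁ h₃ Γ h 𝔣 ιinf hΔ hη).Hol =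
      BallForms.holWeightForms
        ((ballDatumOf (hHD := hHD) (hI := hI) (hU := ballQuotientUniformisedDatum_of h₁) (h₃ := h₃)
          L ι₁ V Γ h).ballImage 𝔣)
        BallForms.isPullbackCocycle_cotangentCocycle :=
  rfl

/-- `pull` of `D_Γ` is the tree's `classPull` (`= toGroup ∘ classLift`). -/
theorem classMapDatumOf_pull (c : (classMapDatumOf hHD hI h₁ h₃ Γ h 𝔣 ιinf hΔ hη).H10) :
    (classMapDatumOf hHD hI h₁ h₃ Γ h 𝔣 ιinf hΔ hη).pull c =
      (ballDatumOf (hHD := hHD) (hI := hI) (hU := ballQuotientUniformisedDatum_of h₁) (h₃ := h₃)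
        L ι₁ V Γ h).classPull hHD 𝔣
        (c : (picardCMUniverse hHD hI h₁ h₃).CohC ((picardCMUniverse hHD hI h₁ h₃).pms L ι₁ V Γ) 1) :=
  rfl

/-- **`pull` and the holomorphic lift are one object**: `pull c g = (Jac g x₀)ᵀ · (classLift c)(g x₀)`. -/
theorem classMapDatumOf_pull_apply (c : (classMapDatumOf hHD hI h₁ h₃ Γ h 𝔣 ιinf hΔ hη).H10)
    (g : U21) :
    ((classMapDatumOf hHD hI h₁ h₃ Γ h 𝔣 ιinf hΔ hη).pull c : U21 → (Fin 2 → ℂ)) g =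
      (Jac g x₀)ᵀ *ᵥ
        (ballDatumOf (hHD := hHD) (hI := hI) (hU := ballQuotientUniformisedDatum_of h₁) (h₃ := h₃)
          L ι₁ V Γ h).classLift hHD 𝔣
          (c : (picardCMUniverse hHD hI h₁ h₃).CohC ((picardCMUniverse hHD hI h₁ h₃).pms L ι₁ V Γ) 1)
          (g • x₀) :=
  (ballDatumOf (hHD := hHD) (hI := hI) (hU := ballQuotientUniformisedDatum_of h₁) (h₃ := h₃)
    L ι₁ V Γ h).classMapDatum_pull_apply hHD 𝔣 hI ιinf hΔ hη c g

/-- **Theta classes are `(1,0)`-classes of `X_Γ`**: for any space `Θ` of adelic weight forms,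
`thetaClasses ιinf D_Γ Θ ⊆ (U.hodge (U.pms L ι₁ V Γ) 1).F 1`. -/
theorem thetaClasses_classMapDatumOf_subset (Θ : Submodule ℂ (weightForms ΓU κ τ)) :
    WeightForms.thetaClasses ιinf (classMapDatumOf hHD hI h₁ h₃ Γ h 𝔣 ιinf hΔ hη) Θ ⊆
      ((picardCMUniverse hHD hI h₁ h₃).hodge ((picardCMUniverse hHD hI h₁ h₃).pms L ι₁ V Γ) 1).F 1 :=
  WeightForms.thetaClasses_subset ιinf _ Θ

/-- **Descent for `D_Γ`, by name**: every holomorphic weight form of level `ballImage 𝔣` is `pull c` for a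
`(1,0)`-class `c` of `X_Γ` (the field `descends`, a theorem). -/
theorem classMapDatumOf_descends
    (f : weightForms
      ((ballDatumOf (hHD := hHD) (hI := hI) (hU := ballQuotientUniformisedDatum_of h₁) (h₃ := h₃)
        L ι₁ V Γ h).ballImage 𝔣) (stabilizer U21 x₀).subtype
      (BallForms.isPullbackCocycle_cotangentCocycle.weightOf x₀))
    (hf : f ∈ (classMapDatumOf hHD hI h₁ h₃ Γ h 𝔣 ιinf hΔ hη).Hol) :
    ∃ c : (classMapDatumOf hHD hI h₁ h₃ Γ h 𝔣 ιinf hΔ hη).H10,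
      (classMapDatumOf hHD hI h₁ h₃ Γ h 𝔣 ιinf hΔ hη).pull c = f :=
  (classMapDatumOf hHD hI h₁ h₃ Γ h 𝔣 ιinf hΔ hη).descends f hf

/-- **`pull` of `D_Γ` is injective** (no junk from `ker pull` in `thetaClasses`; SANITY lane SAN-5, proved in
the tree leaf from `toGroupFun_injective` + `classLift_ne_zero`). -/
theorem classMapDatumOf_pull_injective :
    Function.Injective (classMapDatumOf hHD hI h₁ h₃ Γ h 𝔣 ιinf hΔ hη).pull :=
  (ballDatumOf (hHD := hHD) (hI := hI) (hU := ballQuotientUniformisedDatum_of h₁) (h₃ := h₃)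
    L ι₁ V Γ h).classMapDatum_pull_injective hHD 𝔣 hI ιinf hΔ hη

end EndState

end Model

end HodgeCM

end
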